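import Literature.NumberTheory.Automorphic.BrandtMatrixThetaSeries
import Literature.NumberTheory.Automorphic.BrandtThetaSeriesClassFunction
import Mathlib.LinearAlgebra.Matrix.ToLin
import HarnessLib

/-!
# Stub-ideas k=1 · GEN 9 · `stub_xiDegreeComparison` (crux `SteinbergCore`, line `p6_tamagawa_split`)

Family 1 RECOGNISE & IMPORT. k=1's residual job after gen 8: the ARITHMETIC SUBLATTICE DATUM
`B5Statement S i j l` (gen-8 signature verbatim below) — the ONLY input left between the tree and
H1 = `∀ i j k l, IsCuspForm (Θ_ij − Θ_kl)` (gen 8: `brandtTheta_sub_isCuspForm_of_B5`, 0 sorries).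

GEN-9 RESULT (this file: `lean check` rc 0, **0 sorries**): B5 is PROVED from `(N⁺,N⁻)=1` and B2 —
`b5Statement_of : Nplus.Coprime Nminus → B2Statement S → ∀ i j l, B5Statement S i j l` — via the helpers below, ALL PROVED;
and since B2 is gen 7's theorem and `(N⁺,N⁻)=1` is the tree's `XiSetup.coprime`, the companion file
`STUB_IDEAS_stub_xiDegreeComparison_1_g9_H1complete.lean` (g7 ⊕ g9 ⊕ g8 concatenated, 0 sorries, axioms = {propext,
Classical.choice, Quot.sound}) proves H1 UNCONDITIONALLY, in k2's exact spelling (`ThetaTransferG3.brandtTheta_sub_isCuspForm`).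

GEN-9 CUT of B5 into one-cycle helpers (each RECOGNISED as a routine move of a named toolkit; all PROVED here):
* H-a `exists_mem_reducedNorm_eq_mul_not_dvd`  — single-prime primitivity of `nrd/q_I` on a right ideal
        (`nrdIdeal I = ℤ q_I` is the SPAN of the norms: Voight 16.3.1/16.3.2; tree `XiSetup.nrdIdeal_eq_span_nrdGen`);
* H-b `algebraMap_mul_mem_transporterLeft`      — `q'⁻¹ β z β̄' ∈ (I : I')_L` for `β ∈ I, z ∈ O, β' ∈ I'`
        (`Ī' I' = q' O`: tree `XiSetup.exists_nrdIdeal_eq_span_and_latticeConj_mul_self_eq`);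
* H-c `exists_mem_forall_pow_dvd_reducedNorm_sub` — LATTICE CRT for the norm form: simultaneous local targets
        `nrd y ≡ nrd x_p (mod p^{e_p} q_I)` inside one right ideal (CRT on `I ≅ ℤ⁴`, `Ideal.exists_forall_sub_mem_ideal`,
        + `nrd(x + p^e d) − nrd x = p^{2e} nrd d + p^e trd(x d̄)`, tree `reducedNorm_add`,
        `XiSetup.exists_int_reducedTrace_mul_standardInvolution_eq_mul`);
* H-d (= g6 B4) `smul_standardInvolution_mem_transporterLeft` — `(q'/q) ȳ ∈ (I' : I)_L` for `y ∈ (I : I')_L`;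
* H-e (= B5b) `exists_gram_datum_of_mem_transporterLeft` — BASIS BOOKKEEPING: any `y ∈ (I_j : I_l)_L` with
        `Q_{lj}(y) = n` yields `U, V ∈ M₄(ℤ)`, `ᵗU [T_ij] U = n [T_il]`, `U V = n·1` (`LinearMap.toMatrix`, `toMatrix_comp`,
        tree `XiSetup.cast_dotProduct_normFormGram_mulVec`, `x x̄ = nrd x`);
* H-f (= B5a) `exists_mem_transporterLeft_coprime_modEq` — ASSEMBLY of H-a/H-b/H-c with g7's B2 (taken as the Prop
        `B2Statement`, PROVED in `…_1_g7_Sketch.lean`): `y ∈ (I_j : I_l)_L` with `Q(y) = n ⊥ c`, `n ≡ 1 (mod (c, N/(N,c)))`;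
* H-g `sq_dvd_and_not_dvd_of_dvd_gcd_level` — the modulus `(c, N/(N,c))` lives on primes `p² ∣ N⁺`, `p ∤ N⁻`.
§2: `b5Statement_of : H-f → H-e → B5Statement` (kernel-checked composition).
Evidence / plan file of stub-ideation k=1 (gen 9); not a proposal — a prover lands §0–§2 as one Theorems file (≈ 15 decls).
-/

noncomputable section

open Matrix Module
open scoped MatrixGroups Pointwise

namespace Summit.ABC.ABC.Cruxes.SteinbergCore.StubIdeasK1G9

open Literature.NumberTheory.Automorphic Literature.NumberTheory.Automorphic.Brandt

variable {Nplus Nminus : ℕ} (S : XiSetup Nplus Nminus)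

/-! ## §0 Dictionary (verbatim gen 5/6/8) -/

/-- The Gram matrix `[T_{ij}]` behind `S.brandtTheta i j` (gen 8 §0, verbatim). -/
def brandtGram (i j : ClassSet S.O) : Matrix (Fin 4) (Fin 4) ℤ :=
  normFormGram (S.nonempty_basis_transporterLeft i.rep_mem j.rep_mem).some (S.nrdGen j.rep_mem / S.nrdGen i.rep_mem)

/-- B5 (gen-6/8 signature, verbatim `StubIdeasK1G8.B5Statement`). -/
def B5Statement (i j l : ClassSet S.O) : Prop :=
  ∀ c : ℕ, 0 < c → ∃ n : ℕ, n.Coprime c ∧ n ≡ 1 [MOD Nat.gcd c ((Nplus * Nminus) / Nat.gcd (Nplus * Nminus) c)] ∧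
    ∃ U V : Matrix (Fin 4) (Fin 4) ℤ,
      Uᵀ * brandtGram S i j * U = (n : ℤ) • brandtGram S i l ∧ U * V = (n : ℤ) • (1 : Matrix (Fin 4) (Fin 4) ℤ)

/-- B2 (gen-6 signature; PROVED in gen 7 as `StubIdeasK1G7.exists_mem_order_reducedNorm_modEq_of_not_dvd`,
with `0 < N⁺` from `S.nplus_ne_zero`) as a Prop: unit residues mod `p^e` are reduced norms from `O` at `p ∤ N⁻`. -/
def B2Statement : Prop :=
  ∀ (p : ℕ), p.Prime → ¬ p ∣ Nminus → ∀ (e : ℕ) (t : ℤ), IsCoprime t p →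
    ∃ z ∈ S.O, ∃ nz : ℤ, reducedNorm ℚ S.D z = nz ∧ (p : ℤ) ^ e ∣ nz - t

/-! ## §1 The gen-9 helpers (statements; sizes XS–M; each one prover cycle) -/

/-- **H-a (B1-local, size XS–S, PROVED).** A right `O`-ideal contains an element whose normalised norm `nrd β / q_I`
is prime to a given prime `p`: otherwise every generator `nrd β` of `nrdIdeal I = ℤ q_I` lies in `ℤ (p q_I)`,
so `q_I ∈ ℤ p q_I`, absurd. [cite: Voight2021, Def. 16.3.1 and Lemma 16.3.2] -/
theorem exists_mem_reducedNorm_eq_mul_not_dvd {I : Submodule ℤ S.D} (hI : I ∈ rightIdeals S.O) {p : ℕ} (hp : p.Prime) :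
    ∃ β ∈ I, ∃ m : ℤ, reducedNorm ℚ S.D β = m * S.nrdGen hI ∧ ¬ (p : ℤ) ∣ m := by
  by_contra h
  push Not at h
  have hq := S.nrdGen_pos hI
  have hn := S.nrdIdeal_eq_span_nrdGen hI
  have hle : nrdIdeal I ≤ ℤ ∙ ((p : ℚ) * S.nrdGen hI) := by
    refine nrdIdeal_le_iff.mpr fun x hx => ?_
    obtain ⟨m, hm⟩ := S.exists_int_reducedNorm_eq_mul hn hx
    obtain ⟨k, hk⟩ := h x hx m hm
    rw [Submodule.mem_span_singleton]
    exact ⟨k, by rw [hm, hk, zsmul_eq_mul]; push_cast; ring⟩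
  have hmem : S.nrdGen hI ∈ ℤ ∙ ((p : ℚ) * S.nrdGen hI) :=
    hle (by rw [hn]; exact Submodule.mem_span_singleton_self _)
  rw [Submodule.mem_span_singleton] at hmem
  obtain ⟨k, hk⟩ := hmem
  rw [zsmul_eq_mul] at hk
  have hkp : (k : ℚ) * p = 1 := by
    have h1 : (k : ℚ) * p * S.nrdGen hI = 1 * S.nrdGen hI := by rw [mul_assoc, hk, one_mul]
    exact mul_right_cancel₀ hq.ne' h1
  have hkp' : k * (p : ℤ) = 1 := by exact_mod_cast hkp
  have hdvd : (p : ℤ) ∣ 1 := ⟨k, by rw [mul_comm]; exact hkp'.symm⟩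
  have hp1 : (p : ℤ) = 1 := Int.eq_one_of_dvd_one (by positivity) hdvd
  exact hp.ne_one (by exact_mod_cast hp1)

/-- **H-b (size S, PROVED).** `q'⁻¹ · β z β̄' ∈ (I : I')_L` for `β ∈ I`, `z ∈ O`, `β' ∈ I'`: for `m ∈ I'`, `β̄' m ∈ Ī' I' = q' O`, so
`q'⁻¹ β z β̄' m ∈ β z O ⊆ I`. [cite: Voight2021, 16.6.14 and 41.1.3] -/
theorem algebraMap_mul_mem_transporterLeft {I I' : Submodule ℤ S.D} (hI : I ∈ rightIdeals S.O) (hI' : I' ∈ rightIdeals S.O)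
    {β z β' : S.D} (hβ : β ∈ I) (hz : z ∈ S.O) (hβ' : β' ∈ I') :
    algebraMap ℚ S.D (S.nrdGen hI')⁻¹ * (β * z * standardInvolution ℚ S.D β') ∈ transporterLeft I' I := by
  obtain ⟨q, hq, hn, -, u, hu, hconj, -⟩ := S.exists_nrdIdeal_eq_span_and_latticeConj_mul_self_eq hI'
  have hqq : S.nrdGen hI' = q := S.nrdGen_eq hI' hq hn
  rw [mem_transporterLeft_iff]
  intro m hm
  have h1 : standardInvolution ℚ S.D β' * m ∈ latticeConj I' * I' :=
    Submodule.mul_mem_mul (by rw [mem_latticeConj_iff, standardInvolution_standardInvolution]; exact hβ') hm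
  rw [hconj, mem_units_smul_iff_mul_mem] at h1
  have hinv : ((u⁻¹ : S.Dˣ) : S.D) = algebraMap ℚ S.D q⁻¹ :=
    Units.inv_eq_of_mul_eq_one_right (by rw [hu, ← map_mul, mul_inv_cancel₀ hq.ne', map_one])
  rw [hinv] at h1
  have h2 : z * (algebraMap ℚ S.D q⁻¹ * (standardInvolution ℚ S.D β' * m)) ∈ S.O :=
    S.isEichlerOrder.isOrder.mul_mem _ hz _ h1
  have h3 : β * (z * (algebraMap ℚ S.D q⁻¹ * (standardInvolution ℚ S.D β' * m))) ∈ I := by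
    have hz' : z * (algebraMap ℚ S.D q⁻¹ * (standardInvolution ℚ S.D β' * m)) ∈ rightOrder I := by
      rw [hI.2.1]; exact h2
    exact hz' β hβ
  have heq : algebraMap ℚ S.D (S.nrdGen hI')⁻¹ * (β * z * standardInvolution ℚ S.D β') * m =
      β * (z * (algebraMap ℚ S.D q⁻¹ * (standardInvolution ℚ S.D β' * m))) := by
    simp only [hqq, mul_assoc, Algebra.left_comm]
  rw [heq]
  exact h3

/-- **H-b′ (size XS, PROVED).** Its reduced norm: `nrd(q'⁻¹ β z β̄') = q'⁻² nrd β · nrd z · nrd β'`. [cite: VignerasLNM800, Ch. I §1 Lemme 1.1] -/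
theorem reducedNorm_algebraMap_mul (q : ℚ) (β z β' : S.D) :
    reducedNorm ℚ S.D (algebraMap ℚ S.D q * (β * z * standardInvolution ℚ S.D β')) =
      q ^ 2 * (reducedNorm ℚ S.D β * reducedNorm ℚ S.D z * reducedNorm ℚ S.D β') := by
  rw [reducedNorm_mul_holds, reducedNorm_mul_holds, reducedNorm_mul_holds, reducedNorm_algebraMap,
    reducedNorm_standardInvolution]

/-- **H-c (lattice CRT for the norm form, size S, PROVED).** Finitely many local targets `x_p ∈ I` are met simultaneously:
`∃ y ∈ I` with `nrd y ≡ nrd x_p (mod p^{e_p} · q_I)` for all `p ∈ P` (coordinatewise CRT in `I ≅ ℤ⁴`, then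
`nrd(x + p^e d) = nrd x + p^{2e} nrd d + p^e trd(x d̄)` with `nrd d ∈ ℤ q_I`, `trd(x d̄) ∈ ℤ q_I`). [folklore] -/
theorem exists_mem_forall_pow_dvd_reducedNorm_sub {I : Submodule ℤ S.D} (hI : I ∈ rightIdeals S.O)
    (P : Finset ℕ) (hP : ∀ p ∈ P, p.Prime) (e : ℕ → ℕ) (x : ℕ → S.D) (hx : ∀ p ∈ P, x p ∈ I) :
    ∃ y ∈ I, ∀ p ∈ P, ∃ k : ℤ,
      reducedNorm ℚ S.D y - reducedNorm ℚ S.D (x p) = k * (p : ℚ) ^ e p * S.nrdGen hI := by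
  classical
  obtain ⟨b⟩ := hI.1.nonempty_basis_fin_four
  have hn := S.nrdIdeal_eq_span_nrdGen hI
  -- coordinates of the local targets in the basis `b`
  let g : P → Fin 4 → ℤ := fun p => b.repr ⟨x p, hx p p.2⟩
  -- the moduli `p ^ e p`, `p ∈ P`, are pairwise coprime
  have hcop : Pairwise fun p p' : P =>
      IsCoprime (Ideal.span {((p : ℕ) : ℤ) ^ e p}) (Ideal.span {((p' : ℕ) : ℤ) ^ e p'}) := by
    intro p p' hne
    rw [Ideal.isCoprime_span_singleton_iff]
    have hne' : (p : ℕ) ≠ p' := fun h => hne (Subtype.ext h)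
    have h0 : IsCoprime ((p : ℕ) : ℤ) ((p' : ℕ) : ℤ) :=
      Nat.isCoprime_iff_coprime.mpr ((Nat.coprime_primes (hP p p.2) (hP p' p'.2)).mpr hne')
    exact h0.pow
  -- CRT, one coordinate at a time
  have key : ∀ r : Fin 4, ∃ wr : ℤ, ∀ p : P, wr - g p r ∈ Ideal.span {((p : ℕ) : ℤ) ^ e p} :=
    fun r => Ideal.exists_forall_sub_mem_ideal (I := fun p : P => Ideal.span {((p : ℕ) : ℤ) ^ e p}) hcop (fun p => g p r)
  choose w hw using key
  have key2 : ∀ (p : P) (r : Fin 4), ∃ d : ℤ, w r - g p r = ((p : ℕ) : ℤ) ^ e p * d :=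
    fun p r => Ideal.mem_span_singleton.mp (hw r p)
  choose d hd using key2
  refine ⟨∑ r, w r • (b r : S.D), I.sum_mem fun r _ => I.smul_mem _ (b r).2, fun p hp => ?_⟩
  -- the correction `δ ∈ I` with `y = x_p + p^e • δ`
  set δ : S.D := ∑ r, d ⟨p, hp⟩ r • (b r : S.D) with hδdef
  have hδ : δ ∈ I := I.sum_mem fun r _ => I.smul_mem _ (b r).2
  have hxsum : x p = ∑ r, g ⟨p, hp⟩ r • (b r : S.D) := by
    have h := congrArg Subtype.val (b.sum_repr ⟨x p, hx p hp⟩)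
    simp only [Submodule.coe_sum, Submodule.coe_smul_of_tower] at h
    exact h.symm
  have hy : ∑ r, w r • (b r : S.D) = x p + (((p : ℕ) : ℤ) ^ e p) • δ := by
    rw [hxsum, hδdef, Finset.smul_sum, ← Finset.sum_add_distrib]
    refine Finset.sum_congr rfl fun r _ => ?_
    have hw' : w r = g ⟨p, hp⟩ r + ((p : ℕ) : ℤ) ^ e p * d ⟨p, hp⟩ r := by
      have h := hd ⟨p, hp⟩ r; linear_combination h
    rw [hw', add_smul, mul_smul]
  have hmain : reducedNorm ℚ S.D (∑ r, w r • (b r : S.D)) - reducedNorm ℚ S.D (x p) =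
      ((p : ℚ) ^ e p) ^ 2 * reducedNorm ℚ S.D δ +
        (p : ℚ) ^ e p * reducedTrace ℚ S.D (x p * standardInvolution ℚ S.D δ) := by
    rw [hy, ← Int.cast_smul_eq_zsmul ℚ, reducedNorm_add, reducedNorm_smul, standardInvolution_smul, mul_smul_comm,
      map_smul, smul_eq_mul]
    push_cast
    ring
  obtain ⟨a, ha⟩ := S.exists_int_reducedNorm_eq_mul hn hδ
  obtain ⟨b', hb'⟩ := S.exists_int_reducedTrace_mul_standardInvolution_eq_mul hn (hx p hp) hδ
  refine ⟨(p : ℤ) ^ e p * a + b', ?_⟩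
  rw [hmain, ha, hb']
  push_cast
  ring

/-- **H-d (= gen-6 B4, size S, PROVED).** The involution swaps Eichler's lattices up to the scalar `q'/q`:
`y ∈ (I : I')_L = q'⁻¹ I Ī'` ⇒ `ȳ ∈ q'⁻¹ I' Ī = (q/q') (I' : I)_L`
(tree `XiSetup.exists_transporterLeft_eq_units_inv_smul_mul_latticeConj` twice, `latticeConj_mul`,
`latticeConj_latticeConj`, `standardInvolution_algebraMap`). [cite: Voight2021, 41.1.3 and 16.6.14] -/
theorem smul_standardInvolution_mem_transporterLeft {I I' : Submodule ℤ S.D} (hI : I ∈ rightIdeals S.O)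
    (hI' : I' ∈ rightIdeals S.O) {y : S.D} (hy : y ∈ transporterLeft I' I) :
    algebraMap ℚ S.D (S.nrdGen hI' / S.nrdGen hI) * standardInvolution ℚ S.D y ∈ transporterLeft I I' := by
  obtain ⟨q', u', hq', hn', hu', h'⟩ := S.exists_transporterLeft_eq_units_inv_smul_mul_latticeConj hI hI'
  obtain ⟨q, u, hq, hn, hu, h⟩ := S.exists_transporterLeft_eq_units_inv_smul_mul_latticeConj hI' hI
  have hq'e : S.nrdGen hI' = q' := S.nrdGen_eq hI' hq' hn'
  have hqe : S.nrdGen hI = q := S.nrdGen_eq hI hq hn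
  rw [h', mem_units_smul_iff_mul_mem, inv_inv, hu'] at hy
  rw [h, mem_units_smul_iff_mul_mem, inv_inv, hu, hq'e, hqe]
  have hqq : q * (q' / q) = q' := by field_simp
  have hprod : algebraMap ℚ S.D q * (algebraMap ℚ S.D (q' / q) * standardInvolution ℚ S.D y) =
      standardInvolution ℚ S.D (algebraMap ℚ S.D q' * y) := by
    rw [← mul_assoc, ← map_mul, hqq, standardInvolution_mul_rev, standardInvolution_algebraMap, ← Algebra.commutes]
  have hmem : standardInvolution ℚ S.D (algebraMap ℚ S.D q' * y) ∈ latticeConj (I * latticeConj I') := by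
    rw [mem_latticeConj_iff, standardInvolution_standardInvolution]; exact hy
  rw [latticeConj_mul, latticeConj_latticeConj] at hmem
  rw [hprod]
  exact hmem

/-- Entry formula `(ᵗU G U)_{st} = U_{·s} ⬝ (G U_{·t})` (bookkeeping for H-e). -/
theorem transpose_mul_mul_apply {m : Type*} [Fintype m] (U G : Matrix m m ℤ) (s t : m) :
    (Uᵀ * G * U) s t = (fun r => U r s) ⬝ᵥ (G *ᵥ fun r => U r t) := by
  rw [Matrix.mul_assoc]
  simp only [Matrix.mul_apply, Matrix.transpose_apply, dotProduct, mulVec]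

/-- **H-e (= B5b, basis bookkeeping, size M, PROVED).** Any `y ∈ (I_j : I_l)_L` with `Q_{lj}(y) = nrd(y) q_l/q_j = n` gives the
sublattice datum: `U` = matrix of `w ↦ y w : (I_l : I_i)_L → (I_j : I_i)_L` in the bases behind `brandtGram`, `V` = matrix of
`x ↦ (q_l/q_j) ȳ x` back (H-d); `ᵗU [T_ij] U = n [T_il]` because `trd((y b_s)(y b_t)‾) = nrd(y) trd(b_s b̄_t)`, and
`U V = n · 1` because `y · (q_l/q_j) ȳ = n`. [cite: Voight2021, §40.4 (p. 744) and 41.1.3] -/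
theorem exists_gram_datum_of_mem_transporterLeft (i j l : ClassSet S.O) {y : S.D} (hy : y ∈ transporterLeft l.rep j.rep)
    {n : ℕ} (hn : reducedNorm ℚ S.D y * S.nrdGen l.rep_mem = n * S.nrdGen j.rep_mem) :
    ∃ U V : Matrix (Fin 4) (Fin 4) ℤ,
      Uᵀ * brandtGram S i j * U = (n : ℤ) • brandtGram S i l ∧ U * V = (n : ℤ) • (1 : Matrix (Fin 4) (Fin 4) ℤ) := by
  classical
  set qi := S.nrdGen i.rep_mem with hqi
  set qj := S.nrdGen j.rep_mem with hqj
  set ql := S.nrdGen l.rep_mem with hql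
  have hqi0 : 0 < qi := S.nrdGen_pos i.rep_mem
  have hqj0 : 0 < qj := S.nrdGen_pos j.rep_mem
  have hql0 : 0 < ql := S.nrdGen_pos l.rep_mem
  set bij := (S.nonempty_basis_transporterLeft i.rep_mem j.rep_mem).some with hbij
  set bil := (S.nonempty_basis_transporterLeft i.rep_mem l.rep_mem).some with hbil
  have hGij : brandtGram S i j = normFormGram bij (qj / qi) := rfl
  have hGil : brandtGram S i l = normFormGram bil (ql / qi) := rfl
  have hnij : nrdIdeal (transporterLeft i.rep j.rep) = ℤ ∙ (qj / qi) :=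
    S.nrdIdeal_transporterLeft j.rep_mem i.rep_mem hqj0 hqi0 (S.nrdIdeal_eq_span_nrdGen j.rep_mem)
      (S.nrdIdeal_eq_span_nrdGen i.rep_mem)
  have hnil : nrdIdeal (transporterLeft i.rep l.rep) = ℤ ∙ (ql / qi) :=
    S.nrdIdeal_transporterLeft l.rep_mem i.rep_mem hql0 hqi0 (S.nrdIdeal_eq_span_nrdGen l.rep_mem)
      (S.nrdIdeal_eq_span_nrdGen i.rep_mem)
  have hAij : ∀ r s, ((normFormGram bij (qj / qi) r s : ℤ) : ℚ) * (qj / qi) =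
      reducedTrace ℚ S.D ((bij r : S.D) * standardInvolution ℚ S.D (bij s : S.D)) :=
    fun r s => S.cast_normFormGram_mul (div_pos hqj0 hqi0).ne' hnij bij r s
  have hAil : ∀ r s, ((normFormGram bil (ql / qi) r s : ℤ) : ℚ) * (ql / qi) =
      reducedTrace ℚ S.D ((bil r : S.D) * standardInvolution ℚ S.D (bil s : S.D)) :=
    fun r s => S.cast_normFormGram_mul (div_pos hql0 hqi0).ne' hnil bil r s
  -- `y' := (q_l/q_j) ȳ ∈ (I_l : I_j)_L` with `y y' = n`, `ȳ y = nrd y`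
  set y' := algebraMap ℚ S.D (ql / qj) * standardInvolution ℚ S.D y with hy'def
  have hy' : y' ∈ transporterLeft j.rep l.rep :=
    smul_standardInvolution_mem_transporterLeft S j.rep_mem l.rep_mem hy
  have hsc : ql / qj * reducedNorm ℚ S.D y = n := by
    field_simp
    linear_combination hn
  have hyy' : y * y' = (n : S.D) := by
    rw [hy'def, Algebra.left_comm, mul_standardInvolution_holds ℚ S.D y, ← map_mul, hsc, map_natCast]
  have hbar : standardInvolution ℚ S.D y * y = algebraMap ℚ S.D (reducedNorm ℚ S.D y) := by
    have h := mul_standardInvolution_holds ℚ S.D (standardInvolution ℚ S.D y)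
    rwa [standardInvolution_standardInvolution, reducedNorm_standardInvolution] at h
  -- the two lattice maps
  have hf : ∀ w ∈ transporterLeft i.rep l.rep, y * w ∈ transporterLeft i.rep j.rep := fun w hw m hm => by
    rw [mul_assoc]; exact hy _ (hw m hm)
  have hg : ∀ x ∈ transporterLeft i.rep j.rep, y' * x ∈ transporterLeft i.rep l.rep := fun x hx m hm => by
    rw [mul_assoc]; exact hy' _ (hx m hm)
  set f : transporterLeft i.rep l.rep →ₗ[ℤ] transporterLeft i.rep j.rep := (LinearMap.mulLeft ℤ y).restrict hf
    with hfdef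
  set g : transporterLeft i.rep j.rep →ₗ[ℤ] transporterLeft i.rep l.rep := (LinearMap.mulLeft ℤ y').restrict hg
    with hgdef
  have hf_apply : ∀ w, ((f w : transporterLeft i.rep j.rep) : S.D) = y * w := fun w => rfl
  have hg_apply : ∀ x, ((g x : transporterLeft i.rep l.rep) : S.D) = y' * x := fun x => rfl
  have hfg : f.comp g = (n : ℤ) • LinearMap.id := by
    refine LinearMap.ext fun x => Subtype.ext ?_
    simp only [LinearMap.comp_apply, LinearMap.smul_apply, LinearMap.id_apply, Submodule.coe_smul_of_tower]
    rw [hf_apply, hg_apply, ← mul_assoc, hyy', natCast_zsmul, nsmul_eq_mul]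
  refine ⟨LinearMap.toMatrix bil bij f, LinearMap.toMatrix bij bil g, ?_, ?_⟩
  · -- the Gram identity `ᵗU [T_ij] U = n [T_il]`
    have hcol : ∀ t, ((bij.equivFun.symm (fun r => LinearMap.toMatrix bil bij f r t) : transporterLeft i.rep j.rep) : S.D)
        = y * (bil t : S.D) := by
      intro t
      have h : (fun r => LinearMap.toMatrix bil bij f r t) = ⇑(bij.repr (f (bil t))) := by
        funext r; rw [LinearMap.toMatrix_apply]
      rw [h, Basis.equivFun_symm_apply, Basis.sum_repr, hf_apply]
    ext s t
    rw [hGij, hGil, transpose_mul_mul_apply, Matrix.smul_apply, smul_eq_mul]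
    have h1 := S.cast_dotProduct_normFormGram_mulVec hAij (fun r => LinearMap.toMatrix bil bij f r s)
      (fun r => LinearMap.toMatrix bil bij f r t)
    rw [hcol, hcol] at h1
    have h2 : reducedTrace ℚ S.D ((y * (bil s : S.D)) * standardInvolution ℚ S.D (y * (bil t : S.D))) =
        reducedNorm ℚ S.D y * reducedTrace ℚ S.D ((bil s : S.D) * standardInvolution ℚ S.D (bil t : S.D)) := by
      rw [standardInvolution_mul_rev]
      have h3 : y * (bil s : S.D) * (standardInvolution ℚ S.D (bil t : S.D) * standardInvolution ℚ S.D y)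
          = (y * ((bil s : S.D) * standardInvolution ℚ S.D (bil t : S.D))) * standardInvolution ℚ S.D y := by
        simp only [mul_assoc]
      rw [h3, reducedTrace_mul_comm, ← mul_assoc, hbar, ← Algebra.smul_def, map_smul, smul_eq_mul]
    have hne : (qj / qi : ℚ) ≠ 0 := (div_pos hqj0 hqi0).ne'
    have h4 : ((((fun r => LinearMap.toMatrix bil bij f r s) ⬝ᵥ normFormGram bij (qj / qi) *ᵥ
        fun r => LinearMap.toMatrix bil bij f r t : ℤ)) : ℚ) * (qj / qi) =
        (((n : ℤ) * normFormGram bil (ql / qi) s t : ℤ) : ℚ) * (qj / qi) := by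
      rw [h1, h2, ← hAil s t]
      push_cast
      rw [show reducedNorm ℚ S.D y * ((normFormGram bil (ql / qi) s t : ℚ) * (ql / qi)) =
          (normFormGram bil (ql / qi) s t : ℚ) * (reducedNorm ℚ S.D y * ql) / qi by ring, hn]
      ring
    exact_mod_cast mul_right_cancel₀ hne h4
  · -- `U V = n · 1`
    rw [← LinearMap.toMatrix_comp bij bil bij f g, hfg, map_zsmul, LinearMap.toMatrix_id]

/-- **H-g (size XS–S, elementary, PROVED).** A prime dividing the modulus `(c, N/(N,c))`, `N = N⁺N⁻`, `(N⁺,N⁻) = 1`, `N⁻` squarefree,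
satisfies `p² ∣ N⁺` and `p ∤ N⁻` (so B2 applies at it). [folklore] -/
theorem sq_dvd_and_not_dvd_of_dvd_gcd_level (hcop : Nplus.Coprime Nminus) (hsq : Squarefree Nminus) {c p : ℕ}
    (hp : p.Prime) (hpg : p ∣ Nat.gcd c ((Nplus * Nminus) / Nat.gcd (Nplus * Nminus) c)) :
    p ^ 2 ∣ Nplus ∧ ¬ p ∣ Nminus := by
  set N := Nplus * Nminus with hN
  set d := Nat.gcd N c with hd
  have hpc : p ∣ c := (Nat.dvd_gcd_iff.mp hpg).1
  have hpNd : p ∣ N / d := (Nat.dvd_gcd_iff.mp hpg).2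
  have hdN : d ∣ N := Nat.gcd_dvd_left N c
  have hpN : p ∣ N := hpNd.trans (Nat.div_dvd_of_dvd hdN)
  have hpd : p ∣ d := Nat.dvd_gcd hpN hpc
  have hp2N : p ^ 2 ∣ Nplus * Nminus :=
    calc p ^ 2 = p * p := sq p
      _ ∣ N / d * d := Nat.mul_dvd_mul hpNd hpd
      _ = N := Nat.div_mul_cancel hdN
  have hnot : ¬ p ∣ Nminus := by
    intro hpm
    have hpp : ¬ p ∣ Nplus := fun h =>
      hp.ne_one (Nat.Coprime.eq_one_of_dvd (Nat.Coprime.coprime_dvd_left h hcop) hpm)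
    have hcop2 : (p ^ 2).Coprime Nplus := Nat.Coprime.pow_left 2 ((Nat.Prime.coprime_iff_not_dvd hp).2 hpp)
    have h2m : p ^ 2 ∣ Nminus := hcop2.dvd_of_dvd_mul_left hp2N
    exact hp.ne_one (Nat.isUnit_iff.mp (hsq p (by simpa [sq] using h2m)))
  have hcop3 : (p ^ 2).Coprime Nminus := Nat.Coprime.pow_left 2 ((Nat.Prime.coprime_iff_not_dvd hp).2 hnot)
  exact ⟨hcop3.dvd_of_dvd_mul_right hp2N, hnot⟩

/-- **H-f (= B5a, size M, PROVED — the assembly of H-a, H-b, H-c, H-g with B2).** For classes `j, l` and `c ≥ 1` there is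
`y ∈ (I_j : I_l)_L` whose value `n = Q_{lj}(y) = nrd(y) q_l/q_j` is prime to `c` and `≡ 1 (mod (c, N/(N,c)))`:
local targets `x_p = q_l⁻¹ β_j^{(p)} z_p β̄_l^{(p)}` (`p ∣ c`; H-a at `p` for `β`'s, `z_p = 1` unless `p` divides the modulus,
where `z_p` comes from B2 with `nrd z_p ≡ (m_j m_l)⁻¹`), glued by H-c in the lattice `(I_j : I_l)_L` (a right ideal of
`O_L(I_l)`, setup `S.ofLeftOrder`). [cite: Voight2021, 41.1.3] [cite: VignerasLNM800, Ch. III §5] -/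
theorem exists_mem_transporterLeft_coprime_modEq (hcop : Nplus.Coprime Nminus) (hB2 : B2Statement S)
    (j l : ClassSet S.O) {c : ℕ} (hc : 0 < c) :
    ∃ y ∈ transporterLeft l.rep j.rep, ∃ n : ℕ,
      reducedNorm ℚ S.D y * S.nrdGen l.rep_mem = n * S.nrdGen j.rep_mem ∧ n.Coprime c ∧
        n ≡ 1 [MOD Nat.gcd c ((Nplus * Nminus) / Nat.gcd (Nplus * Nminus) c)] := by
  classical
  -- notation: `q_j`, `q_l`, the modulus `g`, the exponents `E p = v_p(g) + 1`
  set qj := S.nrdGen j.rep_mem with hqj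
  set ql := S.nrdGen l.rep_mem with hql
  have hqj0 : 0 < qj := S.nrdGen_pos j.rep_mem
  have hql0 : 0 < ql := S.nrdGen_pos l.rep_mem
  have hr0 : (0 : ℚ) < qj / ql := div_pos hqj0 hql0
  set g := Nat.gcd c ((Nplus * Nminus) / Nat.gcd (Nplus * Nminus) c) with hg
  have hg0 : g ≠ 0 := (Nat.gcd_pos_of_pos_left _ hc).ne'
  set E : ℕ → ℕ := fun p => g.factorization p + 1 with hE
  -- the lattice `Λ = (I_j : I_l)_L`, a right ideal of `O_L(I_l)` with `nrd(Λ) = ℤ q_j/q_l`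
  set S' := S.ofLeftOrder l.rep_mem with hS'
  have hΛ : transporterLeft l.rep j.rep ∈ rightIdeals S'.O :=
    S.transporterLeft_mem_rightIdeals_leftOrder l.rep_mem j.rep_mem
  have hnΛ : nrdIdeal (transporterLeft l.rep j.rep) = ℤ ∙ (qj / ql) :=
    S.nrdIdeal_transporterLeft j.rep_mem l.rep_mem hqj0 hql0 (S.nrdIdeal_eq_span_nrdGen j.rep_mem)
      (S.nrdIdeal_eq_span_nrdGen l.rep_mem)
  have hgen : S'.nrdGen hΛ = qj / ql := S'.nrdGen_eq hΛ hr0 hnΛ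
  -- the primes of `c`
  set P := c.primeFactors with hPdef
  have hPp : ∀ p ∈ P, p.Prime := fun p hp => (Nat.mem_primeFactors.mp hp).1
  -- H-a at each prime of `c`, for `I_j` and for `I_l`
  have keyj : ∀ p ∈ P, ∃ β ∈ j.rep, ∃ m : ℤ, reducedNorm ℚ S.D β = m * qj ∧ ¬ (p : ℤ) ∣ m :=
    fun p hp => exists_mem_reducedNorm_eq_mul_not_dvd S j.rep_mem (hPp p hp)
  choose! βj hβj mj hmj hpj using keyj
  have keyl : ∀ p ∈ P, ∃ β ∈ l.rep, ∃ m : ℤ, reducedNorm ℚ S.D β = m * ql ∧ ¬ (p : ℤ) ∣ m :=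
    fun p hp => exists_mem_reducedNorm_eq_mul_not_dvd S l.rep_mem (hPp p hp)
  choose! βl hβl ml hml hpl using keyl
  -- the local correctors `z_p ∈ O` (B2 at the primes of the modulus, `1` elsewhere)
  have keyz : ∀ p ∈ P, ∃ z ∈ S.O, ∃ nz : ℤ, reducedNorm ℚ S.D z = nz ∧ ¬ (p : ℤ) ∣ nz * (mj p * ml p) ∧
      (p ∣ g → (p : ℤ) ^ E p ∣ nz * (mj p * ml p) - 1) := by
    intro p hp
    have hpP := hPp p hp
    have hpint : Prime (p : ℤ) := Nat.prime_iff_prime_int.mp hpP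
    have hM : ¬ (p : ℤ) ∣ mj p * ml p := fun h => (hpint.dvd_or_dvd h).elim (hpj p hp) (hpl p hp)
    by_cases hpg : p ∣ g
    · have hpNm : ¬ p ∣ Nminus := (sq_dvd_and_not_dvd_of_dvd_gcd_level hcop S.squarefree hpP hpg).2
      have hcopM : IsCoprime ((p : ℤ) ^ E p) (mj p * ml p) :=
        ((Irreducible.coprime_iff_not_dvd hpint.irreducible).mpr hM).pow_left
      obtain ⟨u, v, huv⟩ := hcopM
      have hvp : IsCoprime v (p : ℤ) := by
        have h1 : IsCoprime v ((p : ℤ) ^ E p) := ⟨mj p * ml p, u, by linear_combination huv⟩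
        have h2 : (p : ℤ) ^ E p = (p : ℤ) ^ g.factorization p * p := pow_succ _ _
        rw [h2] at h1
        exact h1.of_mul_right_right
      obtain ⟨z, hz, nz, hnz, hdvd⟩ := hB2 p hpP hpNm (E p) v hvp
      have hmain : (p : ℤ) ^ E p ∣ nz * (mj p * ml p) - 1 := by
        have h3 : nz * (mj p * ml p) - 1 = (nz - v) * (mj p * ml p) - u * (p : ℤ) ^ E p := by
          linear_combination huv
        rw [h3]
        exact dvd_sub (hdvd.mul_right _) (dvd_mul_left _ _)
      refine ⟨z, hz, nz, hnz, fun h => ?_, fun _ => hmain⟩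
      have h4 : (p : ℤ) ∣ nz * (mj p * ml p) - 1 := (dvd_pow_self (p : ℤ) (Nat.succ_ne_zero _)).trans hmain
      have h5 : (p : ℤ) ∣ 1 := by
        have := dvd_sub h h4
        rwa [sub_sub_cancel] at this
      exact hpint.not_dvd_one h5
    · refine ⟨1, S.isEichlerOrder.isOrder.one_mem, 1, by rw [Int.cast_one]; exact reducedNorm_one ℚ S.D,
        by rwa [one_mul], fun h => (hpg h).elim⟩
  choose! z hz nz hnz hpz hgz using keyz
  -- the local targets `x_p = q_l⁻¹ β_j z_p β̄_l ∈ Λ`, `nrd x_p = (nz·m_j·m_l) · q_j/q_l`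
  set x : ℕ → S.D := fun p => algebraMap ℚ S.D ql⁻¹ * (βj p * z p * standardInvolution ℚ S.D (βl p)) with hx
  have hxΛ : ∀ p ∈ P, x p ∈ transporterLeft l.rep j.rep := fun p hp =>
    algebraMap_mul_mem_transporterLeft S j.rep_mem l.rep_mem (hβj p hp) (hz p hp) (hβl p hp)
  have hxn : ∀ p ∈ P, reducedNorm ℚ S.D (x p) = ((nz p * (mj p * ml p) : ℤ) : ℚ) * (qj / ql) := by
    intro p hp
    simp only [hx]
    rw [reducedNorm_algebraMap_mul, hmj p hp, hnz p hp, hml p hp]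
    push_cast
    field_simp
  -- ONE lattice CRT (H-c) in `Λ`
  obtain ⟨y, hy, hyc⟩ := exists_mem_forall_pow_dvd_reducedNorm_sub S' hΛ P hPp E x hxΛ
  have hyc' : ∀ p ∈ P, ∃ k : ℤ,
      reducedNorm ℚ S.D y - reducedNorm ℚ S.D (x p) = k * (p : ℚ) ^ E p * (qj / ql) := by
    intro p hp
    obtain ⟨k, hk⟩ := hyc p hp
    exact ⟨k, by rw [← hgen]; exact hk⟩
  -- `Q(y) = K ∈ ℤ_{≥ 0}`
  obtain ⟨K, hK⟩ := S.exists_int_reducedNorm_eq_mul hnΛ hy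
  have hK0 : 0 ≤ K := by
    have h0 : 0 ≤ reducedNorm ℚ S.D y := reducedNorm_nonneg_of_isTotallyDefinite _ S.isTotallyDefinite y
    rw [hK] at h0
    by_contra hneg
    push Not at hneg
    have : (K : ℚ) * (qj / ql) < 0 := mul_neg_of_neg_of_pos (by exact_mod_cast hneg) hr0
    linarith
  have hKA : ∀ p ∈ P, ∃ k : ℤ, K - nz p * (mj p * ml p) = k * (p : ℤ) ^ E p := by
    intro p hp
    obtain ⟨k, hk⟩ := hyc' p hp
    refine ⟨k, ?_⟩
    rw [hK, hxn p hp, ← sub_mul] at hk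
    have h1 := mul_right_cancel₀ hr0.ne' hk
    exact_mod_cast h1
  have hKn : ((K.toNat : ℕ) : ℤ) = K := Int.toNat_of_nonneg hK0
  refine ⟨y, hy, K.toNat, ?_, ?_, ?_⟩
  · have h1 : ((K.toNat : ℕ) : ℚ) = (K : ℚ) := by exact_mod_cast hKn
    rw [h1, hK]
    field_simp
  · refine Nat.coprime_of_dvd fun p hp hpK hpc => ?_
    have hpP : p ∈ P := Nat.mem_primeFactors.mpr ⟨hp, hpc, hc.ne'⟩
    obtain ⟨k, hk⟩ := hKA p hpP
    have h1 : (p : ℤ) ∣ K := by rw [← hKn]; exact Int.natCast_dvd_natCast.mpr hpK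
    have h2 : (p : ℤ) ∣ k * (p : ℤ) ^ E p := (dvd_pow_self (p : ℤ) (Nat.succ_ne_zero _)).mul_left _
    have h3 : (p : ℤ) ∣ nz p * (mj p * ml p) := by
      have := dvd_sub h1 h2
      rwa [← hk, sub_sub_cancel] at this
    exact hpz p hpP h3
  · -- `K ≡ 1 (mod g)`, prime power by prime power
    have hdiv : (g : ℤ) ∣ K - 1 := by
      rw [Int.natCast_dvd]
      refine (Nat.dvd_iff_prime_pow_dvd_dvd _ _).mpr fun p k hp hpk => ?_
      rcases Nat.eq_zero_or_pos k with rfl | hk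
      · simp
      have hkle : k ≤ g.factorization p := (hp.pow_dvd_iff_le_factorization hg0).mp hpk
      have hpg : p ∣ g := (dvd_pow_self p hk.ne').trans hpk
      have hpc : p ∣ c := hpg.trans (Nat.gcd_dvd_left _ _)
      have hpP : p ∈ P := Nat.mem_primeFactors.mpr ⟨hp, hpc, hc.ne'⟩
      obtain ⟨t, ht⟩ := hKA p hpP
      have h1 : (p : ℤ) ^ E p ∣ K - 1 := by
        have h2 : K - 1 = t * (p : ℤ) ^ E p + (nz p * (mj p * ml p) - 1) := by linear_combination ht
        rw [h2]
        exact dvd_add (dvd_mul_left _ _) (hgz p hpP hpg)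
      have h3 : ((p ^ k : ℕ) : ℤ) ∣ K - 1 := by
        push_cast
        exact (pow_dvd_pow (p : ℤ) (hkle.trans (Nat.le_succ _))).trans h1
      exact Int.natCast_dvd.mp h3
    rw [Nat.modEq_iff_dvd]
    push_cast [hKn]
    exact dvd_sub_comm.mp hdiv

/-! ## §2 Composition: B5 from H-f and H-e (kernel-checked) -/

/-- **B5 ⟸ (N⁺,N⁻)=1 + B2 (PROVED, via H-f + H-e).** With gen 7's B2, the tree's `XiSetup.coprime` and gen 8's
`brandtTheta_sub_isCuspForm_of_B5` this gives H1 unconditionally (`…_1_g9_H1complete.lean`). -/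
theorem b5Statement_of (hcop : Nplus.Coprime Nminus) (hB2 : B2Statement S) (i j l : ClassSet S.O) :
    B5Statement S i j l := by
  intro c hc
  obtain ⟨y, hy, n, hn, hnc, hmod⟩ := exists_mem_transporterLeft_coprime_modEq S hcop hB2 j l hc
  obtain ⟨U, V, hU, hV⟩ := exists_gram_datum_of_mem_transporterLeft S i j l hy hn
  exact ⟨n, hnc, hmod, U, V, hU, hV⟩

end Summit.ABC.ABC.Cruxes.SteinbergCore.StubIdeasK1G9
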